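import Summits.QuantumFields.YangMills.Theorems.BalabanLadderIRTwistedSpectralDatum

/-!
# LINE 1 «equipartition_seam» — (F) in spectral form: an INSERTED twisted spectral datum gives flux domination

Workfile for the crux `BalabanLadder.IRcof` (stmt-QuantumFields-26930), stub S4ᵛ `EBlindUnitsV` of
`Cruxes/IRcof/Lines/equipartition_seam.lean` (rev 7).  Ideator ym-ir-idea-22 g5; answers crit-3 g5's PASS-WITH-PRICE on the located
input «(F) flux domination» (bus 2026-08-29T00:21:41Z, prices P1–P3, reuse-by-name D).

CONTENT.  `HasInsertedTwistedSpectralDatum z w K`: the twisted traces `z c τ` AND the twisted traces with an insertion `w c τ` are carried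
by ONE joint spectral datum — eigenvalues `λᵢ ≥ 0`, unit multiplicative flux labels `χᵢ`, and diagonal insertion coefficients `|bᵢ| ≤ K`
(`w c τ = Σᵢ χᵢ(c) λᵢ^τ bᵢ`).  This is what the Loewner domination `−K·𝕋ˢ ⪯ 𝔸 ⪯ K·𝕋ˢ` of an interior slab insertion delivers in the joint
eigenbasis of (transfer matrix, centre twists) — with the FULL time extent, so crit-3's price P1 (thin insertion) does not arise for
interior insertions; P2 (twist-commuting) is the existence of the joint datum; P3 (flux positivity) is the case `b ≡ 1`.
`fluxDomination_of_inserted`: such a datum gives, for every multiplicative unit character `ψ` of the flux group,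
`‖Σ_c ψ(c) w c τ‖ ≤ K · Re Σ_c ψ(c) z c τ` — the hypothesis `hdom` of `FluxFourier.eblind_of_fluxDomination`
(`Lines/equipartition_seam_FluxFourier.lean`).  Reuses `TwistCost.char_trivial_or_sum_eq_zero` by name.

HONEST FRAMING.  Abstract transfer-matrix bookkeeping (adapter class); the located content of S4ᵛ — that the split-weight sector data of the
H-torus Wilson measure carry such a datum with `K = ‖A.F‖∞` — is NOT proved here; nothing here proves `IRcof`, `IR`, a lattice gap or the
Yang–Mills mass gap (Clay); `R4` closes only the conditional finite-𝕋⁴ rung `BalabanLadder.UV`.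
-/

set_option autoImplicit false

noncomputable section

open scoped BigOperators
open Finset

namespace Summit.QuantumFields.YangMills.Cruxes.IRcof.EquipartitionSeam.FluxInsertion

variable {Zc : Type} [CommGroup Zc] [Fintype Zc]

/-- **Inserted twisted spectral datum**: joint eigen-data `(λᵢ ≥ 0, χᵢ)` carrying the twisted traces `z c (m+2) = Σᵢ χᵢ(c) λᵢ^{m+2}` and
the inserted twisted traces `w c (m+2) = Σᵢ χᵢ(c) λᵢ^{m+2} bᵢ` with real diagonal insertion coefficients `|bᵢ| ≤ K`. -/
def HasInsertedTwistedSpectralDatum (z w : Zc → ℕ → ℝ) (K : ℝ) : Prop :=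
  ∃ (ι : Type) (lam : ι → ℝ) (χ : ι → Zc → ℂ) (b : ι → ℝ),
    (∀ i, 0 ≤ lam i) ∧ (∀ i a a', χ i (a * a') = χ i a * χ i a') ∧ (∀ i a, ‖χ i a‖ = 1) ∧ (∀ i, |b i| ≤ K) ∧
    (∀ (c : Zc) (m : ℕ), HasSum (fun i => χ i c * ((lam i : ℂ) ^ (m + 2))) ((z c (m + 2) : ℝ) : ℂ)) ∧
    (∀ (c : Zc) (m : ℕ), HasSum (fun i => χ i c * ((lam i : ℂ) ^ (m + 2)) * (b i : ℂ)) ((w c (m + 2) : ℝ) : ℂ))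

/-- The character sum `Σ_c ψ(c) χ(c)` of a product of two multiplicative unit characters is a non-negative real (`0` or `|Zc|`). -/
theorem sum_mul_char_eq_real (ψ χ : Zc → ℂ) (hψ : ∀ a a', ψ (a * a') = ψ a * ψ a') (hχ : ∀ a a', χ (a * a') = χ a * χ a') :
    ∃ s : ℝ, 0 ≤ s ∧ ∑ c, ψ c * χ c = (s : ℂ) := by
  have hmul : ∀ a a', (fun c => ψ c * χ c) (a * a') = (fun c => ψ c * χ c) a * (fun c => ψ c * χ c) a' := by
    intro a a'
    simp only [hψ, hχ]
    ring
  rcases Summit.QuantumFields.YangMills.Cruxes.IR.TwistCost.char_trivial_or_sum_eq_zero (fun c => ψ c * χ c) hmul with h | h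
  · refine ⟨Fintype.card Zc, by positivity, ?_⟩
    have : ∑ c, ψ c * χ c = ∑ _c : Zc, (1 : ℂ) := Finset.sum_congr rfl (fun c _ => h c)
    rw [this]
    simp
  · exact ⟨0, le_rfl, by simpa using h⟩

/-- **(F) from an inserted spectral datum.**  For every multiplicative character `ψ` of the flux group:
`‖Σ_c ψ(c) w c (m+2)‖ ≤ K · Re Σ_c ψ(c) z c (m+2)`. -/
theorem fluxDomination_of_inserted {z w : Zc → ℕ → ℝ} {K : ℝ}
    (h : HasInsertedTwistedSpectralDatum z w K) (m : ℕ) (ψ : Zc → ℂ)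
    (hψ : ∀ a a', ψ (a * a') = ψ a * ψ a') :
    ‖∑ c, ψ c * ((w c (m + 2) : ℝ) : ℂ)‖ ≤ K * (∑ c, ψ c * ((z c (m + 2) : ℝ) : ℂ)).re := by
  obtain ⟨ι, lam, χ, b, hlam, hχmul, -, hb, hz, hw⟩ := h
  -- the character sums `S i = Σ_c ψ c χ_i c` are non-negative reals
  choose s hs0 hs using fun i => sum_mul_char_eq_real ψ (χ i) hψ (hχmul i)
  -- joint HasSum statements for the flux coefficients
  have hZ : HasSum (fun i => ((s i * lam i ^ (m + 2) : ℝ) : ℂ)) (∑ c, ψ c * ((z c (m + 2) : ℝ) : ℂ)) := by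
    have h1 := hasSum_sum (s := (Finset.univ : Finset Zc))
      (f := fun c i => ψ c * (χ i c * ((lam i : ℂ) ^ (m + 2))))
      (a := fun c => ψ c * ((z c (m + 2) : ℝ) : ℂ)) (fun c _ => (hz c m).mul_left (ψ c))
    refine h1.congr_fun ?_
    intro i
    have : ∑ c, ψ c * (χ i c * ((lam i : ℂ) ^ (m + 2))) = (∑ c, ψ c * χ i c) * ((lam i : ℂ) ^ (m + 2)) := by
      rw [Finset.sum_mul]
      exact Finset.sum_congr rfl (fun c _ => by ring)
    rw [this, hs i]
    push_cast
    ring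
  have hW : HasSum (fun i => ((s i * lam i ^ (m + 2) * b i : ℝ) : ℂ)) (∑ c, ψ c * ((w c (m + 2) : ℝ) : ℂ)) := by
    have h1 := hasSum_sum (s := (Finset.univ : Finset Zc))
      (f := fun c i => ψ c * (χ i c * ((lam i : ℂ) ^ (m + 2)) * (b i : ℂ)))
      (a := fun c => ψ c * ((w c (m + 2) : ℝ) : ℂ)) (fun c _ => (hw c m).mul_left (ψ c))
    refine h1.congr_fun ?_
    intro i
    have : ∑ c, ψ c * (χ i c * ((lam i : ℂ) ^ (m + 2)) * (b i : ℂ)) =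
        (∑ c, ψ c * χ i c) * ((lam i : ℂ) ^ (m + 2)) * (b i : ℂ) := by
      rw [Finset.sum_mul, Finset.sum_mul]
      exact Finset.sum_congr rfl (fun c _ => by ring)
    rw [this, hs i]
    push_cast
    ring
  -- pass to real and imaginary parts
  set Zh : ℂ := ∑ c, ψ c * ((z c (m + 2) : ℝ) : ℂ) with hZh
  set Wh : ℂ := ∑ c, ψ c * ((w c (m + 2) : ℝ) : ℂ) with hWh
  have hZre : HasSum (fun i => s i * lam i ^ (m + 2)) Zh.re := by
    have h1 := Complex.hasSum_re hZ
    refine h1.congr_fun (fun i => ?_)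
    simp only [Complex.ofReal_re]
  have hWre : HasSum (fun i => s i * lam i ^ (m + 2) * b i) Wh.re := by
    have h1 := Complex.hasSum_re hW
    refine h1.congr_fun (fun i => ?_)
    simp only [Complex.ofReal_re]
  have hWim : Wh.im = 0 := by
    have h1 : HasSum (fun i => ((s i * lam i ^ (m + 2) * b i : ℝ) : ℂ).im) Wh.im := Complex.hasSum_im hW
    have h2 : HasSum (fun _ : ι => (0 : ℝ)) Wh.im := by
      refine h1.congr_fun (fun i => ?_)
      simp only [Complex.ofReal_im]
    exact (h2.unique hasSum_zero)
  -- termwise bounds `± K · sᵢ λᵢ^τ`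
  have hnn : ∀ i, 0 ≤ s i * lam i ^ (m + 2) := fun i => mul_nonneg (hs0 i) (pow_nonneg (hlam i) _)
  have hup : Wh.re ≤ K * Zh.re := by
    refine hasSum_le (fun i => ?_) hWre (hZre.mul_left K)
    have := (abs_le.mp (hb i)).2
    calc s i * lam i ^ (m + 2) * b i ≤ s i * lam i ^ (m + 2) * K :=
          mul_le_mul_of_nonneg_left this (hnn i)
      _ = K * (s i * lam i ^ (m + 2)) := by ring
  have hlo : -(K * Zh.re) ≤ Wh.re := by
    have hneg : HasSum (fun i => -(K * (s i * lam i ^ (m + 2)))) (-(K * Zh.re)) := (hZre.mul_left K).neg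
    refine hasSum_le (fun i => ?_) hneg hWre
    have := (abs_le.mp (hb i)).1
    calc -(K * (s i * lam i ^ (m + 2))) = s i * lam i ^ (m + 2) * (-K) := by ring
      _ ≤ s i * lam i ^ (m + 2) * b i := mul_le_mul_of_nonneg_left this (hnn i)
  -- conclude: `‖Wh‖ = |Wh.re|`
  have hnorm : ‖Wh‖ = |Wh.re| := by
    have : Wh = (Wh.re : ℂ) := Complex.ext (by simp) (by simp [hWim])
    rw [this, Complex.norm_real, Real.norm_eq_abs, Complex.ofReal_re]
  rw [hnorm]
  exact abs_le.mpr ⟨hlo, hup⟩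

/-- The same with the flux character given as an additive character of `Additive Zc` (the form `FluxFourier` consumes). -/
theorem fluxDomination_of_inserted_addChar {z w : Zc → ℕ → ℝ} {K : ℝ}
    (h : HasInsertedTwistedSpectralDatum z w K) (m : ℕ) (ψ : AddChar (Additive Zc) ℂ) :
    ‖∑ c : Zc, ψ (Additive.ofMul c) * ((w c (m + 2) : ℝ) : ℂ)‖ ≤
      K * (∑ c : Zc, ψ (Additive.ofMul c) * ((z c (m + 2) : ℝ) : ℂ)).re :=
  fluxDomination_of_inserted h m (fun c => ψ (Additive.ofMul c))
    (fun a a' => by rw [ofMul_mul, AddChar.map_add_eq_mul])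

/-- Flux positivity (crit-3's P3) is the case `b ≡ 1`: `0 ≤ Re Σ_c ψ(c) z c (m+2)` whenever the traces carry a joint datum. -/
theorem fluxPositive_of_inserted {z w : Zc → ℕ → ℝ} {K : ℝ}
    (h : HasInsertedTwistedSpectralDatum z w K) (m : ℕ) (ψ : Zc → ℂ)
    (hψ : ∀ a a', ψ (a * a') = ψ a * ψ a') (hK : 0 < K) :
    0 ≤ (∑ c, ψ c * ((z c (m + 2) : ℝ) : ℂ)).re := by
  have h1 := fluxDomination_of_inserted h m ψ hψ
  have h2 : 0 ≤ K * (∑ c, ψ c * ((z c (m + 2) : ℝ) : ℂ)).re := le_trans (norm_nonneg _) h1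
  by_contra hlt
  push Not at hlt
  have : K * (∑ c, ψ c * ((z c (m + 2) : ℝ) : ℂ)).re < 0 := mul_neg_of_pos_of_neg hK hlt
  linarith

end Summit.QuantumFields.YangMills.Cruxes.IRcof.EquipartitionSeam.FluxInsertion

end
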